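import Summits.QuantumFields.YangMills.Theorems.LuscherReductionRunningReductionKTRCalibration
import Summits.QuantumFields.YangMills.Theorems.FemtoTransferGapLevelsPos
import HarnessLib

/-!
# Crux RED, line «KTR» rev 3: the non-vacuity certificate of `stub_dressedRitz` made UNCONDITIONAL — `RunningReduction ⟹ DressedRitz`

Support module (fleet service by seat ym-infvol-p2) for crux `RunningReduction` (route `LuscherReduction`, item stmt-QuantumFields-19978), line «KTR»
rev 3.  `KTRCalibration.dressedRitz_of_runningReduction` (module `…KTRCalibration`) derives the rev-3 `DressedRitz` text of the line's load-bearing witness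
stub from RED GIVEN the fixed-lattice spectral attainment as a hypothesis, and `…KTRCertificate.dressedRitz_of_runningReduction_oneSiteLevels` discharged
that hypothesis from crux ONE (via `levelValue_pos_of_red_one`: RED ∧ ONE ⟹ `0 < λ_k` deep in the window).  Now that `0 < levelValue su2Rep L β k` holds for
EVERY `k` and `β > 0` (`FemtoTransferGapLevelsPos.levelValue_su2Rep_pos`, from Lüscher's 1977 strict positivity of the transfer matrix), the attainment
hypothesis is a tree theorem on the whole femto window (`exists_isPhys_eigenfamily_of_pos`) and the certificate needs NO second crux:

**`dressedRitz_of_runningReduction_unconditional : RunningReduction → ⟨rev-3 DressedRitz text⟩`** — the crux ALONE implies the statement of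
`stub_dressedRitz` (witnesses = the exact zero-flux eigenfunctions); so the KTR line's witness stub is implied by its target, with no detour through ONE.

HONEST FRAMING: fixed-lattice functional analysis; proves nothing OF RED ∕ 3a′ ∕ 3b′ ∕ `ExplicitNoIntruder`; femto rung R2b1 only; not a gap, not Clay.
References: [cite: Luscher1983]; [cite: Luscher1977]; M. Reed, B. Simon IV (1978) XIII.1 [cite: ReedSimonIV1978].
-/

set_option autoImplicit false

noncomputable section

open MeasureTheory Filter Topology Real
open Literature.MathematicalPhysics.QuantumFieldTheory
open Literature.MathematicalPhysics.QuantumLattice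
open Literature.Analysis.OperatorTheory.YMMatrixModel

namespace Summit.QuantumFields.YangMills.Theorems.FemtoTransferGap.KTRCalibration

open Summit.QuantumFields.YangMills.Theorems.FemtoTransferGap

/-- **Spectral attainment on the femto window, as the hypothesis `hatt` of `dressedRitz_of_runningReduction` (DISCHARGED)**: for every `L ≥ 1`,
`β ≥ 1` and `k` there are physical `l2`-orthonormal exact eigenfunctions `φ₀ … φ_k` with `K_β φ_j = λ_j φ_j`. [cite: Luscher1977, §3] [cite: ReedSimonIV1978, Thm. XIII.1] -/
theorem attainment_of_window :
    ∀ (L : ℕ) [NeZero L] (β : ℝ) (k : ℕ), 1 ≤ β →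
      ∃ φ : Fin (k + 1) → (GaugeConfig 3 L SU2 → ℝ),
        (∀ i, IsPhys (φ i)) ∧
        (∀ i l, l2 (φ i) (φ l) = if i = l then 1 else 0) ∧
        (∀ i, transferApply β (φ i) = levelValue su2Rep L β i • φ i) :=
  fun L _ _ k hβ1 => exists_isPhys_eigenfamily_of_pos (L := L) (zero_lt_one.trans_le hβ1) k

/-- **`RunningReduction ⟹ DressedRitz`, unconditionally** (the rev-3 `DressedRitz` text VERBATIM, as in `dressedRitz_of_runningReduction`): crux RED alone
implies the statement of the KTR line's witness stub `stub_dressedRitz` — witnesses the exact zero-flux eigenfunctions (attainment `attainment_of_window`),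
Ritz ratios = RED's two product inequalities with one constant, residual `≡ 0`, top capture from `m₀ = λ₀`.  Supersedes the ONE-conditional certificate
`dressedRitz_of_runningReduction_oneSiteLevels`. [cite: Luscher1983] [cite: Luscher1977, §3] -/
theorem dressedRitz_of_runningReduction_unconditional
    (hRED : Summit.QuantumFields.YangMills.Theses.LuscherReduction.RunningReduction) :
    ∀ k : ℕ, ∀ η : ℝ, 0 < η → ∃ C lam0 : ℝ, 0 < lam0 ∧ ∀ lam : ℝ, 0 < lam → lam ≤ lam0 →
    ∃ L0 : ℕ, ∀ (L : ℕ) [NeZero L], L0 ≤ L → ∀ β : ℝ, InFemtoWindow lam β L →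
      ∃ φ : Fin (k + 1) → (GaugeConfig 3 L SU2 → ℝ),
        (∀ i, IsPhys (φ i)) ∧
        (∀ i l, l2 (φ i) (φ l) = if i = l then 1 else 0) ∧
        (∀ i l, i ≠ l → qform su2Rep β (φ i) (φ l) = 0) ∧
        (∀ i l : Fin (k + 1), i ≤ l → qform su2Rep β (φ l) (φ l) ≤ qform su2Rep β (φ i) (φ i)) ∧
        (∀ j : Fin (k + 1),
          qform su2Rep β (φ j) (φ j) * levelValue su2Rep 1 (oneSiteCoupling β L) 0 ≤
              Real.exp (C * luscherLambda β L ^ 2 / L) *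
                (levelValue su2Rep 1 (oneSiteCoupling β L) j * qform su2Rep β (φ 0) (φ 0)) ∧
            levelValue su2Rep 1 (oneSiteCoupling β L) j * qform su2Rep β (φ 0) (φ 0) ≤
              Real.exp (C * luscherLambda β L ^ 2 / L) *
                (qform su2Rep β (φ j) (φ j) * levelValue su2Rep 1 (oneSiteCoupling β L) 0)) ∧
        (∀ c : Fin (k + 1) → ℝ,
          l2 (∑ i, c i • (transferApply β (φ i) - qform su2Rep β (φ i) (φ i) • φ i))
             (∑ i, c i • (transferApply β (φ i) - qform su2Rep β (φ i) (φ i) • φ i)) ≤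
            C * (luscherLambda β L ^ 3 / (L : ℝ) ^ 2) * qform su2Rep β (φ 0) (φ 0) ^ 2 * ∑ i, c i ^ 2) ∧
        (∀ ψ : GaugeConfig 3 L SU2 → ℝ, IsPhys ψ →
          qform su2Rep β ψ ψ ≤ Real.exp (η * luscherLambda β L / L) * qform su2Rep β (φ 0) (φ 0) * l2 ψ ψ) :=
  dressedRitz_of_runningReduction attainment_of_window hRED

end Summit.QuantumFields.YangMills.Theorems.FemtoTransferGap.KTRCalibration

end
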